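import Literature.Probability.LatticeModels.RandomClusterFreePercolationProbability
import HarnessLib

/-!
# FK sub-lane, item (F3): the boundary-condition seam `θ⁰(p,q) = θ¹(p,q)` as a named target, and its discharge for
# FK–Ising (`q = 2`) at the critical point from Raoufi's Proposition 1

Support file (`--supports stmt-CriticalPhenomena-4575`), FK sub-lane `prim-bschramm-fk-1` (gen 2) of the post-continuity
programme; builds on p205010 (kernel theorem, internal audit signed; external expert review pending).  No named facts of our own,
no sorries; standard axioms.  Statements staged by the literature cell (prim-cplus-literature gen 41, consumer sheet
`FKUniqueAtCriticalOfRaoufi.lean`) on top of its Literature file `RandomClusterFreePercolationProbability.lean` (p211286: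
`thetaFree` = θ⁰ of Grimmett 2006 (5.1) with free boundary conditions, `thetaFree_le_thetaWired`,
`thetaFree_eq_thetaWired_of_edgeDensity_eq` = Grimmett 2006 Thm. (5.16)(c) 'if' half, and the `q = 2` corollaries of the nearest-neighbour
Edwards–Sokal edge-density dictionary); landed here because `Summits/…/Theorems/` is prover-only.

* `FK.FKUniqueAt d p q` — THE BOUNDARY-CONDITION SEAM of block (D) of the chain at the working point `(p, q)`: `θ⁰(p,q) = θ¹(p,q)`
  (for `q ≥ 1` equivalent to uniqueness of the infinite-volume random-cluster measure, Grimmett 2006 Thm. (5.16)(c) with Thm. (4.63)).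
  This is the hypothesis under which wired finite-volume inputs of Kozma–Nitzan's Theorem 6 transfer to the free phase (lane memo
  bschramm/FK-Q2.md §4–§5; lead verdicts V20, V26, V31: the typed `q = 2` chain reads
  `Theorem A_FK + SamePWitness_FK(2) ⇐ AdditiveGluingFK 2 + KN §4 for φ_{p,2} + FKUniqueAt d (p_c(2)) 2`).
* `FK.fkUniqueAt_criticalProb_two_of_raoufi` — **(F3)**: conditional on the tree's named fact `Raoufi2020_nn_freeCorr_eq_plusCorr`
  (Raoufi 2020, Prop. 1: `⟨σ_0σ_{eᵢ}⟩⁺_β = ⟨σ_0σ_{eᵢ}⟩^∅_β` on `ℤ^d` at every `β ≥ 0`; unproved in the tree — this theorem is CONDITIONAL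
  on it and says so in its signature), `FKUniqueAt d (p_c(2)) 2` for every `d ≥ 2`.
* `FK.fkUniqueAt_fkIsingParam_two_of_raoufi` — the same at every `p = 1 − e^{−2β}`, `β ≥ 0`, `d ≥ 1` (Raoufi 2020 Cor. 3).
* `FK.fkUniqueAt_iff_thetaFree_ge` — for `p ∈ [0,1]`, `q ≥ 1` the seam is the single inequality `θ¹ ≤ θ⁰` (`θ⁰ ≤ θ¹` is the tree's
  `thetaFree_le_thetaWired`).
* `FK.thetaFree_eq_zero_of_fkUniqueAt` — under the seam, `θ¹(p,q) = 0 → θ⁰(p,q) = 0` and conversely (trivial rewriting; recorded so that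
  consumers quantify over one `θ`).
Nothing is claimed about `q ≠ 2`, and nothing unconditional about `q = 2` beyond the tree's `thetaFree_rcCriticalProb_two_eq_zero`.
[cite: Grimmett2006, Thm. (5.16)(c), Thm. (4.63), §5.1 (5.1)–(5.3)] [cite: Raoufi2020, Prop. 1 and Cor. 3]
-/

noncomputable section

namespace Summit.CriticalPhenomena.PercolationContinuityZ3.Theorems

namespace FK

open Literature.Probability.LatticeModels Literature.Barriers.CriticalPhenomena

/-- **The boundary-condition seam at `(p, q)`**: `θ⁰(p,q) = θ¹(p,q)` on `ℤ^d` — the free and wired percolation probabilities of the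
random-cluster model agree (for `q ≥ 1` this is equivalent to uniqueness of the infinite-volume random-cluster measure at `(p,q)`,
Grimmett 2006 Thm. (5.16)(c) with Thm. (4.63)).  The hypothesis under which block (D) of the chain (Kozma–Nitzan Thm. 6) transplants
to FK(`q`) (lane memo bschramm/FK-Q2.md §5). [cite: Grimmett2006, Thm. (5.16)(c) and Thm. (4.63)] -/
def FKUniqueAt (d : ℕ) (p q : ℝ) : Prop := thetaFree d p q = thetaWired d p q

/-- Unfolding lemma. [cite: Grimmett2006, Thm. (5.16)(c)] -/
theorem fkUniqueAt_iff (d : ℕ) (p q : ℝ) : FKUniqueAt d p q ↔ thetaFree d p q = thetaWired d p q := Iff.rfl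

/-- For `p ∈ [0,1]` and `q ≥ 1` the seam is the single inequality `θ¹(p,q) ≤ θ⁰(p,q)` (the other one, `θ⁰ ≤ θ¹`, is the comparison
between boundary conditions, tree theorem `thetaFree_le_thetaWired`). [cite: Grimmett2006, Thm. (5.16)(c); Lemma (4.14)(b)] -/
theorem fkUniqueAt_iff_thetaWired_le (d : ℕ) {p q : ℝ} (hp : p ∈ Set.Icc (0 : ℝ) 1) (hq : 1 ≤ q) :
    FKUniqueAt d p q ↔ thetaWired d p q ≤ thetaFree d p q :=
  ⟨fun h => h.symm.le, fun h => le_antisymm (thetaFree_le_thetaWired hp hq) h⟩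

/-- Under the seam the two percolation probabilities vanish together. [cite: Grimmett2006, Thm. (5.16)(c)] -/
theorem thetaFree_eq_zero_iff_of_fkUniqueAt {d : ℕ} {p q : ℝ} (h : FKUniqueAt d p q) :
    thetaFree d p q = 0 ↔ thetaWired d p q = 0 := by
  rw [show thetaFree d p q = thetaWired d p q from h]

/-- **(F3)**: conditional on the tree's named fact `Raoufi2020_nn_freeCorr_eq_plusCorr` (Raoufi 2020, Prop. 1), the FK–Ising model on
`ℤ^d`, `d ≥ 2`, has no boundary-condition seam at its critical point: `θ⁰(p_c(2), 2) = θ¹(p_c(2), 2)` — the literature cell's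
`thetaFree_rcCriticalProb_two_eq_thetaWired_of_raoufi` (Grimmett 2006 Thm. (5.16)(c) fed with the nearest-neighbour Edwards–Sokal
edge-density dictionary) read as the lane's named target.  CONDITIONAL on the Raoufi fact (hypothesis `h`).
[cite: Raoufi2020, Prop. 1 and Cor. 3] [cite: Grimmett2006, Thm. (5.16)(c), (5.2) and Thm. (5.17)] -/
theorem fkUniqueAt_criticalProb_two_of_raoufi (h : Raoufi2020_nn_freeCorr_eq_plusCorr) :
    ∀ d : ℕ, 2 ≤ d → FKUniqueAt d (rcCriticalProb d 2) 2 :=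
  fun _ hd => thetaFree_rcCriticalProb_two_eq_thetaWired_of_raoufi h hd

/-- The same at EVERY FK–Ising parameter `p = 1 − e^{−2β}`, `β ≥ 0`, `d ≥ 1` (Raoufi 2020 Cor. 3: the infinite-volume FK–Ising measure
on `ℤ^d` is unique at every `p`).  CONDITIONAL on the Raoufi fact (hypothesis `h`). [cite: Raoufi2020, Prop. 1 and Cor. 3] -/
theorem fkUniqueAt_fkIsingParam_two_of_raoufi (h : Raoufi2020_nn_freeCorr_eq_plusCorr) {d : ℕ} (hd : 1 ≤ d) {β : ℝ}
    (hβ : 0 ≤ β) : FKUniqueAt d (fkIsingParam β) 2 :=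
  thetaFree_eq_thetaWired_two_of_raoufi h hd hβ

/-- **Both phases of critical FK–Ising are non-percolating on `ℤ^d`, `d ≥ 3`** — `θ⁰(p_c(2),2) = θ¹(p_c(2),2) = 0`: the wired half is the
tree theorem `thetaWired_rcCriticalProb_two_eq_zero` (Aizenman–Duminil-Copin–Sidoravicius 2015 through Grimmett's (5.19)), the free
half the literature cell's unconditional `thetaFree_rcCriticalProb_two_eq_zero` (`0 ≤ θ⁰ ≤ θ¹`).  Unconditional; recorded next to the
seam so that consumers of `FKUniqueAt d (p_c(2)) 2` see what is already known without Raoufi's fact.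
[cite: AizenmanDuminilCopinSidoraviciusCMP2015, Thm. 1.2 with Cor. 1.5 (1)] [cite: Grimmett2006, §5.1 (5.1)–(5.3)] -/
theorem thetaFree_and_thetaWired_rcCriticalProb_two_eq_zero {d : ℕ} (hd : 3 ≤ d) :
    thetaFree d (rcCriticalProb d 2) 2 = 0 ∧ thetaWired d (rcCriticalProb d 2) 2 = 0 :=
  ⟨thetaFree_rcCriticalProb_two_eq_zero hd, thetaWired_rcCriticalProb_two_eq_zero hd⟩

/-- Hence, for `d ≥ 3`, the seam AT THE CRITICAL POINT of FK–Ising holds unconditionally (both sides vanish); Raoufi's fact is what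
gives it at every `p` and in `d = 2`. [cite: AizenmanDuminilCopinSidoraviciusCMP2015, Thm. 1.2 with Cor. 1.5 (1)]
[cite: Grimmett2006, Thm. (5.16)(c)] -/
theorem fkUniqueAt_criticalProb_two_of_three_le {d : ℕ} (hd : 3 ≤ d) : FKUniqueAt d (rcCriticalProb d 2) 2 := by
  obtain ⟨h0, h1⟩ := thetaFree_and_thetaWired_rcCriticalProb_two_eq_zero hd
  exact h0.trans h1.symm

end FK

end Summit.CriticalPhenomena.PercolationContinuityZ3.Theorems

end
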